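import Summits.ResolutionOfSingularities.ResolutionOfSingularities.Theorems.RadicialJungCleanModelsT2BlowupStalkChart
import Mathlib.AlgebraicGeometry.FunctionField
import Mathlib.Algebra.CharP.Frobenius
import HarnessLib

/-!
# Route `RadicialJung`, crux `CleanModels` (stmt-15917): a global function which is not a `p`-th
# power in `K(X)` is not a `p`-th power in any stalk, nor in the image of a stalk in `K(X)`
# (T2 utility for `stub_lemma23` / `stub_readOff_critical`)

Support file (OURS) for PROGRAMME-clean-dim2 / T2. The skeleton's standing hypothesis is
`hf : ∀ c : K(X), c ^ p ≠ f_η`; the chart-level closers (res-L0-w81-pv-1's `…GiraudStepPoint*`,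
res-rescue-typ-5's B7 closer) consume `f_ξ ∉ (frobenius 𝒪_{X,ξ} p).range`, resp. the same for the
image `R` of `𝒪_{X,ξ}` in `K(X)`. Nothing here is a statement of Hironaka's manuscript.

* `germ_ne_pow_of_functionField` — `g ^ p ≠ f_ξ` for every `g ∈ 𝒪_{X,ξ}`;
* `germ_not_mem_range_frobenius` — `f_ξ ∉ (frobenius 𝒪_{X,ξ} p).range`;
* `range_germ_ne_pow`, `range_germ_not_mem_range_frobenius` — the same for
  `R = im(𝒪_{X,ξ} → K(X))` and the image of `f_ξ` in `R`.
-/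

noncomputable section

set_option linter.dupNamespace false -- mandated namespace of this single-conjunct summit

open CategoryTheory AlgebraicGeometry TopologicalSpace IsLocalRing
open Literature.AlgebraicGeometry.Resolution

namespace Summit.ResolutionOfSingularities.ResolutionOfSingularities.Theorems.RadicialJung.CleanModels.T2

universe u

variable {X : Scheme.{u}} [IsIntegral X] (p : ℕ) (f : Γ(X, ⊤))
  (hf : ∀ c : X.functionField, c ^ p ≠ X.presheaf.germ ⊤ (genericPoint X) trivial f)

include hf in
/-- **`f_ξ` is not a `p`-th power in `𝒪_{X,ξ}`** if `f_η` is not a `p`-th power in `K(X)`.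
[folklore] -/
theorem germ_ne_pow_of_functionField (ξ : X) (g : X.presheaf.stalk ξ) :
    g ^ p ≠ X.presheaf.germ ⊤ ξ trivial f := by
  intro hg
  haveI : Nonempty (⊤ : X.Opens) := ⟨⟨ξ, trivial⟩⟩
  apply hf (algebraMap (X.presheaf.stalk ξ) X.functionField g)
  rw [← map_pow, hg, Scheme.algebraMap_germ_eq_germToFunctionField]

include hf in
/-- `f_ξ ∉ im(Frobenius)` on the stalk. [folklore] -/
theorem germ_not_mem_range_frobenius [Fact p.Prime] (ξ : X) [CharP (X.presheaf.stalk ξ) p] :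
    X.presheaf.germ ⊤ ξ trivial f ∉ (frobenius (X.presheaf.stalk ξ) p).range := by
  rintro ⟨g, hg⟩
  exact germ_ne_pow_of_functionField p f hf ξ g (by rw [← hg, frobenius_def])

include hf in
/-- **The image of `f_ξ` in `R = im(𝒪_{X,ξ} → K(X))` is not a `p`-th power in `R`.** [folklore] -/
theorem range_germ_ne_pow (ξ : X) (g : (algebraMap (X.presheaf.stalk ξ) X.functionField).range) :
    g ^ p ≠ ⟨algebraMap (X.presheaf.stalk ξ) X.functionField (X.presheaf.germ ⊤ ξ trivial f),
      _, rfl⟩ := by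
  obtain ⟨e, he⟩ := exists_ringEquiv_range _ (IsFractionRing.injective (X.presheaf.stalk ξ)
    X.functionField)
  intro hg
  have h1 : e (X.presheaf.germ ⊤ ξ trivial f) =
      ⟨algebraMap (X.presheaf.stalk ξ) X.functionField (X.presheaf.germ ⊤ ξ trivial f), _, rfl⟩ :=
    Subtype.ext (he _)
  apply germ_ne_pow_of_functionField p f hf ξ (e.symm g)
  apply e.injective
  rw [map_pow, e.apply_symm_apply, hg, h1]

include hf in
/-- The image of `f_ξ` in `R` is not in the image of the Frobenius of `R`. [folklore] -/
theorem range_germ_not_mem_range_frobenius [Fact p.Prime] (ξ : X)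
    [CharP (algebraMap (X.presheaf.stalk ξ) X.functionField).range p] :
    (⟨algebraMap (X.presheaf.stalk ξ) X.functionField (X.presheaf.germ ⊤ ξ trivial f), _, rfl⟩ :
        (algebraMap (X.presheaf.stalk ξ) X.functionField).range) ∉
      (frobenius (algebraMap (X.presheaf.stalk ξ) X.functionField).range p).range := by
  rintro ⟨g, hg⟩
  exact range_germ_ne_pow p f hf ξ g (by rw [← hg, frobenius_def])

end Summit.ResolutionOfSingularities.ResolutionOfSingularities.Theorems.RadicialJung.CleanModels.T2

end
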